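import Summits.ResolutionOfSingularities.ResolutionOfSingularities.Theorems.HilbertSamuelEliminationCampaignW42DirectrixAugment
import Summits.ResolutionOfSingularities.ResolutionOfSingularities.Theorems.HilbertSamuelEliminationCampaignW42ThickeningSwap
import Summits.ResolutionOfSingularities.ResolutionOfSingularities.Theorems.HilbertSamuelEliminationCampaignW42DirectrixSections
import HarnessLib

/-!
# [OURS · L1 W4.2] The DIRECTRIX of a cone does not grow under localization at a near prime, over EVERY coefficient field:
# `e(O_{C,𝔓})_K + dim S/𝔓 ≤ e(C)_K` whenever `H(S/I) ≤ H⁽ᵈ⁾(O_{C,𝔓})` (campaign s42, cell res-hironaka; informal crux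
# `RidgeConfinement`, stmt-ResolutionOfSingularities-17845; `--supports`; brick D3 of the directrix form of CJS Thm. 3.10 (4))

HONEST FRAMING. OURS (slot W4.2, prover res-L1-s42-pv-1, gen 6). [OURS · L1 W4.2] replaces the role of nothing printed in
H. Hironaka's manuscript. The tree's `localRidgeDim_add_le_ridgeDim_of_hilbertFunQuot_le_hilbertSamuelFun` (gen 5, B7) is the
RIDGE form of Dietel's (8.2.7.B) for cones; this file runs the SAME «Λ-trick» chain — thickening `B = (T[Y])_𝔔`
(`…ConePointThickening`), its second face `B/𝔪_{S_𝔓}B ≅ O_{C_L,x̄}` (`…ConePointResidueRational`), the collapse of the Hilbert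
functions, the cone theorem `x̄ ∈ F(C_L)(L)` and the translation `O_{C_L,x̄} ≅ O_{C_L,0}` (`…ConeVertexRidge`) — for the
DIRECTRIX DIMENSION `e(·)_K` over an ARBITRARY field `K ⊇ κ(𝔓)` (imperfect allowed). What is new is only bookkeeping: every
local ring of the chain is augmented to `L = κ(𝔓)` (`…CampaignW42DirectrixAugment`), so that `K` sits compatibly over all residue
fields; the second face with its action on `T[Y]` is `…CampaignW42ThickeningSwap`; the sections cost directrix dimensions by
`…CampaignW42DirectrixSections`.

* `dirDimOver_conePrime_add_le` — the chain at the concrete local ring `O = T_{𝔓/I}`, for `K` over `L = κ(𝔓)` and `κ(O)` compatibly;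
* **`dirDimOver_add_le_directrixDim_of_hilbertFunQuot_le_hilbertSamuelFun`** — THE CONE THEOREM FOR THE DIRECTRIX: `I ⊆ K₀[X]`
  homogeneous without linear forms, `𝔓 ⊇ I` prime, `d = dim S/𝔓`, `Lo` a localization of `S/I` at `𝔓/I` with
  `H(S/I) ≤ H⁽ᵈ⁾(Lo)`, and ANY field `K` over `κ(Lo)`: `e(Lo)_K + d ≤ e(I · K[X])` along `K₀ → S/I → Lo → κ(Lo) → K`.

NOT a statement of H. Hironaka's manuscript [Hironaka2017]. AI review is weaker than expert review. References (orientation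
only): B. Dietel, Dissertation Regensburg (2015), Satz (8.2.7) p. 105, (8.2.3)–(8.2.6); V. Cossart, U. Jannsen, S. Saito,
LNM 2270 (2020), Thm. 3.10 (4), proof p. 46–50; H. Hironaka, J. Math. Kyoto Univ. 7 (1967), Thm. (1,A).
-/

noncomputable section

-- single-conjunct summit: the doubled namespace component `ResolutionOfSingularities` is mandated
set_option linter.dupNamespace false
-- localizations of polynomial rings over quotient rings: nested instance problems (as in the gen-3/4/5 files)
set_option maxSynthPendingDepth 3

open IsLocalRing MvPolynomial Module
open Literature.RingTheory.HilbertSamuel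
open Literature.RingTheory.MvPolynomial (idealDegree shift directrixDim)
open Literature.AlgebraicGeometry.Resolution

namespace Summit.ResolutionOfSingularities.ResolutionOfSingularities.Theorems

namespace CampaignW42

universe u

/-! ## The chain for `e(·)_K` at the concrete local ring `O = T_{𝔓/I}` -/

section Structure

variable {K : Type u} [Field K] {n : ℕ} {I 𝔓 : Ideal (MvPolynomial (Fin n) K)} (hI𝔓 : I ≤ 𝔓)
  (L : Type u) [Field L] [Algebra (MvPolynomial (Fin n) K ⧸ 𝔓) L] [IsFractionRing (MvPolynomial (Fin n) K ⧸ 𝔓) L]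
  {Q : Ideal (MvPolynomial (Fin n) (MvPolynomial (Fin n) K ⧸ I))} [Q.IsPrime]
  (hQ : Q = RingHom.ker (eval₂Hom ((algebraMap (MvPolynomial (Fin n) K ⧸ 𝔓) L).comp (Ideal.Quotient.factor hI𝔓))
    (fun i : Fin n => algebraMap (MvPolynomial (Fin n) K ⧸ 𝔓) L (Ideal.Quotient.mk 𝔓 (X i)))))
  [𝔓.IsPrime] {P' : Ideal (MvPolynomial (Fin n) K ⧸ I)} [P'.IsPrime] (hP' : P' = 𝔓.map (Ideal.Quotient.mk I))

/-- [notation] `T = S/I`, the coordinate ring of the cone. -/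
local notation3 "T" => MvPolynomial (Fin n) K ⧸ I
/-- [notation] `D = S/𝔓`. -/
local notation3 "D" => MvPolynomial (Fin n) K ⧸ 𝔓
/-- [notation] `x̄ ∈ Lⁿ`, the images of the variables. -/
local notation3 "xbar" => fun i : Fin n => algebraMap (MvPolynomial (Fin n) K ⧸ 𝔓) L (Ideal.Quotient.mk 𝔓 (X i))
/-- [notation] `φ : T → D → L`. -/
local notation3 "φ" => (algebraMap (MvPolynomial (Fin n) K ⧸ 𝔓) L).comp (Ideal.Quotient.factor hI𝔓)
/-- [notation] `ψ : T[Y] → L`. -/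
local notation3 "ψ" => eval₂Hom ((algebraMap (MvPolynomial (Fin n) K ⧸ 𝔓) L).comp (Ideal.Quotient.factor hI𝔓)) xbar
/-- [notation] `I_D = I · D[X]`. -/
local notation3 "ID" => I.map (MvPolynomial.map (algebraMap K (MvPolynomial (Fin n) K ⧸ 𝔓)))
/-- [notation] `I_L = I · L[X]`, written as in `…ConePointResidueRational` (through `D[X] → L[X]`). -/
local notation3 "IL" => (I.map (MvPolynomial.map (algebraMap K (MvPolynomial (Fin n) K ⧸ 𝔓)))).map
  (@algebraMap (MvPolynomial (Fin n) (MvPolynomial (Fin n) K ⧸ 𝔓)) (MvPolynomial (Fin n) L) _ _ MvPolynomial.algebraMvPolynomial)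
/-- [notation] `ι₂ : S = K[Y] → T[Y]`. -/
local notation3 "ι₂" => MvPolynomial.map (σ := Fin n) (algebraMap K (MvPolynomial (Fin n) K ⧸ I))
/-- [notation] `E₂ = 𝔓(Y) · T[Y]`. -/
local notation3 "E₂" => 𝔓.map ι₂
/-- [notation] the thickening `B = (T[Y])_𝔔`. -/
local notation3 "B" => Localization.AtPrime Q
/-- [notation] `O = O_{C,𝔓}`. -/
local notation3 "O" => Localization.AtPrime P'
/-- [notation] `Rp = S_𝔓`, the regular side. -/
local notation3 "Rp" => Localization.AtPrime 𝔓
/-- [notation] `θ₂ : Rp → B`, the structure map of the regular side. -/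
local notation3 "θ₂" => Localization.localRingHom 𝔓 Q (MvPolynomial.map (σ := Fin n) (algebraMap K (MvPolynomial (Fin n) K ⧸ I)))
  (prime_eq_comap_ι₂ hI𝔓 L hQ)
/-- [notation] the forward swap map `f₁ : T[Y] → D[X]/I_D`. -/
local notation3 "f₁" => eval₂Hom (Ideal.Quotient.lift I ((Ideal.Quotient.mk ID).comp
    (MvPolynomial.map (algebraMap K D))) (fun _ hq => le_ker_mk_comp_map hq))
    (fun i => Ideal.Quotient.mk ID (C (Ideal.Quotient.mk 𝔓 (X i))))

/-- [notation] `G₁ : T[Y] → L[X]/I_L`, the swap followed by `D[X]/I_D → L[X]/I_L` (coefficients through `K → L`,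
`Y_i ↦ x̄_i`). -/
local notation3 "G₁" => eval₂Hom (Ideal.Quotient.lift I ((Ideal.Quotient.mk IL).comp
    (MvPolynomial.map ((algebraMap D L).comp (algebraMap K D)))) (fun _ hq => le_ker_mk_comp_map_coneIdealL L hq))
    (fun i => Ideal.Quotient.mk IL (C (algebraMap (MvPolynomial (Fin n) K ⧸ 𝔓) L (Ideal.Quotient.mk 𝔓 (X i)))))

include hI𝔓 hQ hP' in
-- (`maxHeartbeats`: as above — the chain carries five local rings presented as localizations of polynomial quotients)
set_option maxHeartbeats 800000 in
/-- **The cone theorem for the DIRECTRIX, at the concrete local ring `O = T_{𝔓/I}`**: if `I` is homogeneous without linear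
forms and `H(S/I) ≤ H⁽ᵈ⁾(O)`, `d = dim S/𝔓`, then for every field `K'` over `L = κ(𝔓)` and over `κ(O)` compatibly,
`e(O)_{K'} + d ≤ e(I · K'[X])`. [cite: CossartJannsenSaito2020, Thm. 3.10 (4)] [cite: Dietel2015, Satz (8.2.7) p. 105] -/
theorem dirDimOver_conePrime_add_le (hI : IsHomogeneousIdeal I) (hI1 : finrank K (idealDegree I 1) = 0) {d : ℕ}
    (hd : ringKrullDim (MvPolynomial (Fin n) K ⧸ 𝔓) = d) (hH : hilbertFunQuot K n I ≤ hilbertSamuelFun O d)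
    (K' : Type u) [Field K'] [Algebra L K'] [Algebra (ResidueField O) K']
    (hcO : ∀ t : T, algebraMap (ResidueField O) K' (residue O (algebraMap T O t)) = algebraMap L K' (φ t)) :
    dirDimOver O K' + d ≤
      directrixDim (I.map (MvPolynomial.map ((algebraMap L K').comp ((algebraMap D L).comp (algebraMap K D))))) := by
  classical
  set τ : L →+* K' := algebraMap L K' with hτ
  -- the ideal `I_L` of the cone `C_L`
  have hIL_eq := coneIdealL_eq_map (I := I) (𝔓 := 𝔓) L
  have hILhom : IsHomogeneousIdeal IL := by rw [hIL_eq]; exact isHomogeneousIdeal_map _ hI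
  have hIL1 : finrank L (idealDegree IL 1) = 0 := by rw [hIL_eq]; exact finrank_idealDegree_map_one_eq_zero hI _ hI1
  have hHIL : hilbertFunQuot L n IL = hilbertFunQuot K n I := by rw [hIL_eq]; exact hilbertFunQuot_map _ hI
  have hILv : IL ≤ RingHom.ker (eval xbar) := coneIdealL_le_ker_eval hI𝔓 L
  have hIL0 : IL ≤ RingHom.ker (eval (0 : Fin n → L)) := by
    intro f hf
    rw [RingHom.mem_ker, MvPolynomial.eval_zero, constantCoeff_eq]
    by_contra hc
    have h0 : homogeneousComponent 0 f ∈ IL := hILhom f hf 0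
    rw [homogeneousComponent_zero] at h0
    have htop : IL = ⊤ := Ideal.eq_top_of_isUnit_mem _ h0 ((isUnit_iff_ne_zero.mpr hc).map C)
    exact RingHom.ker_ne_top (eval xbar) (top_le_iff.mp (htop.symm.trans_le hILv))
  haveI hmaxv : ((RingHom.ker (eval xbar)).map (Ideal.Quotient.mk IL)).IsMaximal := isMaximal_map_ker_eval hILv
  haveI hmax0 : ((RingHom.ker (eval (0 : Fin n → L))).map (Ideal.Quotient.mk IL)).IsMaximal := isMaximal_map_ker_eval hIL0
  set Lv := Localization.AtPrime ((RingHom.ker (eval xbar)).map (Ideal.Quotient.mk IL)) with hLvdef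
  set L₀ := Localization.AtPrime ((RingHom.ker (eval (0 : Fin n → L))).map (Ideal.Quotient.mk IL)) with hL₀def
  -- (0) augmentations: `ρ_B : B → L` extending `ψ`, `ρ_v : Lv → L` extending evaluation at `x̄`
  have hkerψ : RingHom.ker ψ = Q := hQ.symm
  obtain ⟨ρB, hρB, hρB0⟩ := exists_ringHom_of_ker_eq ψ Q hkerψ B
  haveI hρBloc : IsLocalHom ρB := isLocalHom_of_forall_mem_maximalIdeal ρB hρB0
  let evL : (MvPolynomial (Fin n) L ⧸ IL) →+* L := Ideal.Quotient.lift IL (eval xbar) (fun f hf => hILv hf)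
  have hkerev : RingHom.ker evL = (RingHom.ker (eval xbar)).map (Ideal.Quotient.mk IL) := Ideal.ker_quotient_lift _ _
  obtain ⟨ρv, hρv, hρv0⟩ := exists_ringHom_of_ker_eq evL _ hkerev Lv
  haveI hρvloc : IsLocalHom ρv := isLocalHom_of_forall_mem_maximalIdeal ρv hρv0
  have hρvL : ∀ c : L, ρv (algebraMap L Lv c) = c := fun c => by
    rw [IsScalarTower.algebraMap_apply L (MvPolynomial (Fin n) L ⧸ IL) Lv, ← RingHom.comp_apply, hρv,
      IsScalarTower.algebraMap_apply L (MvPolynomial (Fin n) L) (MvPolynomial (Fin n) L ⧸ IL), Ideal.Quotient.algebraMap_eq,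
      MvPolynomial.algebraMap_eq]
    change Ideal.Quotient.lift IL (eval xbar) _ (Ideal.Quotient.mk IL (C c)) = c
    rw [Ideal.Quotient.lift_mk, eval_C]
  -- the field `K'` over `κ(B)` and `κ(Lv)`
  letI algB : Algebra (ResidueField B) K' := (τ.comp (ResidueField.lift ρB)).toAlgebra
  letI algLv : Algebra (ResidueField Lv) K' := (τ.comp (ResidueField.lift ρv)).toAlgebra
  -- (1) the thickening
  have hHB : hilbertFun B = hilbertSamuelFun O n := hilbertFun_thickening hI𝔓 L hQ hP'
  have hRB : dirDimOver B K' = dirDimOver O K' + n := by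
    letI algOB : Algebra O B :=
      (Localization.localRingHom P' Q (C : T →+* MvPolynomial (Fin n) T) (conePoint_eq_comap_C hI𝔓 L hQ hP')).toAlgebra
    haveI := flat_thickening hI𝔓 L hQ hP'
    haveI : IsLocalHom (algebraMap O B) := Localization.isLocalHom_localRingHom _ _ _ _
    obtain ⟨hreg, hdim⟩ := isRegularLocalRing_thickening_fibre hI𝔓 L hQ hP'
    haveI := hreg
    refine dirDimOver_eq_add_of_flat_of_isRegularLocalRing_fiber hdim K' ?_
    refine residueField_ringHom_ext P' O fun t => ?_
    rw [RingHom.comp_apply, ResidueField.map_residue, hcO t]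
    change τ (ResidueField.lift ρB (residue B _)) = τ (φ t)
    rw [ResidueField.lift_residue_apply]
    congr 1
    change ρB (Localization.localRingHom P' Q (C : T →+* MvPolynomial (Fin n) T) _ (algebraMap T O t)) = _
    rw [Localization.localRingHom_to_map, ← RingHom.comp_apply, hρB, coe_eval₂Hom, eval₂_C]
  -- (2) the regular side and the surjection `Φ : B → Lv` with kernel on `h` generators
  obtain ⟨h, t, hhd, ht⟩ := exists_span_eq_maximalIdeal_regularSide (𝔓 := 𝔓) hd
  have hker : (maximalIdeal Rp).map θ₂ = (E₂).map (algebraMap (MvPolynomial (Fin n) T) B) :=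
    map_maximalIdeal_regularSide hI𝔓 L hQ
  obtain ⟨e, he⟩ := exists_ringEquiv_thickening_mod_regular hI𝔓 L hQ
  let Φ : B →+* Lv := e.toRingHom.comp (Ideal.Quotient.mk ((E₂).map (algebraMap (MvPolynomial (Fin n) T) B)))
  have hΦsurj : Function.Surjective Φ := e.surjective.comp Ideal.Quotient.mk_surjective
  have hΦker : RingHom.ker Φ = Ideal.span (Set.range (θ₂ ∘ t)) := by
    change RingHom.ker (e.toRingHom.comp _) = _
    rw [← RingHom.comap_ker, (RingHom.injective_iff_ker_eq_bot e.toRingHom).mp e.injective, ← RingHom.ker_eq_comap_bot,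
      Ideal.mk_ker, ← hker, ← ht, Ideal.map_span, ← Set.range_comp]
  have ht𝔪 : ∀ j, (θ₂ ∘ t) j ∈ maximalIdeal B := fun j =>
    map_nonunit θ₂ (t j) (by rw [← ht]; exact Ideal.subset_span ⟨j, rfl⟩)
  letI algBLv : Algebra B Lv := Φ.toAlgebra
  -- `ρ_v ∘ Φ = ρ_B`: the swap carries the point `𝔔` to the point `x̄`
  have hevG : evL.comp G₁ = ψ := by
    refine ringHom_ext (fun t => ?_) (fun i => ?_)
    · obtain ⟨s, rfl⟩ := Ideal.Quotient.mk_surjective t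
      have hR : ψ (C (Ideal.Quotient.mk I s)) = algebraMap D L (Ideal.Quotient.mk 𝔓 s) := by
        rw [coe_eval₂Hom, eval₂_C, RingHom.comp_apply, Ideal.Quotient.factor_mk]
      have hL : G₁ (C (Ideal.Quotient.mk I s)) =
          Ideal.Quotient.mk IL (MvPolynomial.map ((algebraMap D L).comp (algebraMap K D)) s) := by
        rw [coe_eval₂Hom, eval₂_C, Ideal.Quotient.lift_mk, RingHom.comp_apply]
      rw [RingHom.comp_apply, hR, hL]
      change Ideal.Quotient.lift IL (eval xbar) _ (Ideal.Quotient.mk IL _) = _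
      rw [Ideal.Quotient.lift_mk, MvPolynomial.eval_map, ← coe_eval₂Hom]
      exact eval₂Hom_tautological (algebraMap D L) s
    · rw [RingHom.comp_apply, coe_eval₂Hom, eval₂_X, coe_eval₂Hom, eval₂_X]
      change Ideal.Quotient.lift IL (eval xbar) _ (Ideal.Quotient.mk IL _) = _
      rw [Ideal.Quotient.lift_mk, eval_C]
  have hρΦ : ρv.comp Φ = ρB := by
    refine IsLocalization.ringHom_ext Q.primeCompl (S := B) ?_
    rw [hρB, ← hevG]
    refine RingHom.ext fun p => ?_
    rw [RingHom.comp_apply, RingHom.comp_apply, RingHom.comp_apply]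
    change ρv (e (Ideal.Quotient.mk _ (algebraMap (MvPolynomial (Fin n) T) B p))) = _
    rw [he p, ← RingHom.comp_apply ρv, hρv]
    rfl
  have hKc : ∀ b : B, algebraMap (ResidueField Lv) K' (residue Lv (algebraMap B Lv b)) =
      algebraMap (ResidueField B) K' (residue B b) := fun b => by
    change τ (ResidueField.lift ρv (residue Lv (Φ b))) = τ (ResidueField.lift ρB (residue B b))
    rw [ResidueField.lift_residue_apply, ResidueField.lift_residue_apply, ← hρΦ]
    rfl
  -- (3) the chain of Hilbert functions
  have ha : hilbertSamuelFun B 1 ≤ hilbertSamuelFun Lv (h + 1) := by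
    rw [add_comm h 1]
    exact hilbertSamuelFun_le_of_ker_le_span_range hΦsurj (θ₂ ∘ t) ht𝔪 hΦker.le 1
  have hc3 : hilbertSamuelFun Lv (h + 1) ≤ hilbertSamuelFun L₀ (h + 1) := by
    rw [← iterPSum_hilbertSamuelFun Lv h 1, ← iterPSum_hilbertSamuelFun L₀ h 1]
    exact iterPSum_mono h (hilbertSamuelFun_one_localization_cone_le hILhom xbar Lv L₀)
  have he0 : hilbertFun L₀ = hilbertFunQuot K n I := (hilbertFun_localization_vertex_eq_hilbertFunQuot hILhom L₀).trans hHIL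
  have hc4 : hilbertSamuelFun L₀ (h + 1) = iterPSum (h + 1) (hilbertFunQuot K n I) := by
    change iterPSum (h + 1) (hilbertFun L₀) = _
    rw [he0]
  have hc2 : hilbertSamuelFun B 1 = hilbertSamuelFun O (n + 1) := by
    change iterPSum 1 (hilbertFun B) = _
    rw [hHB, iterPSum_hilbertSamuelFun O 1 n, add_comm]
  have hc1 : iterPSum (h + 1) (hilbertFunQuot K n I) ≤ hilbertSamuelFun B 1 := by
    rw [hc2, show n + 1 = (h + 1) + d by omega, ← iterPSum_hilbertSamuelFun O (h + 1) d]
    exact iterPSum_mono (h + 1) hH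
  have hBv : hilbertSamuelFun B 1 = hilbertSamuelFun Lv (h + 1) :=
    le_antisymm ha (hc3.trans ((hc4.trans_le hc1)))
  have hv0 : hilbertSamuelFun Lv (h + 1) = hilbertSamuelFun L₀ (h + 1) :=
    le_antisymm hc3 ((hc4.trans_le hc1).trans ha)
  -- (4) `x̄` is in the ridge of `C_L`; `e(Lv)_{K'} = e(I · K'[X])`
  have hridge : (fun i : Fin n => algebraMap (MvPolynomial (Fin n) K ⧸ 𝔓) L (Ideal.Quotient.mk 𝔓 (X i))) ∈ ridge L IL := by
    refine (mem_ridge_iff_hilbertSamuelFun_eq hILhom xbar Lv L₀).mpr (iterPSum_injective h ?_)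
    rw [iterPSum_hilbertSamuelFun Lv h 1, iterPSum_hilbertSamuelFun L₀ h 1]
    exact hv0
  have hcv : (algebraMap (ResidueField Lv) K').comp (algebraMap L (ResidueField Lv)) = τ := by
    refine RingHom.ext fun c => ?_
    change τ (ResidueField.lift ρv (algebraMap L (ResidueField Lv) c)) = τ c
    rw [IsScalarTower.algebraMap_apply L Lv (ResidueField Lv)]
    change τ (ResidueField.lift ρv (residue Lv (algebraMap L Lv c))) = τ c
    rw [ResidueField.lift_residue_apply, hρvL]
  have hRv : dirDimOver Lv K' = directrixDim (I.map (MvPolynomial.map (τ.comp ((algebraMap D L).comp (algebraMap K D))))) := by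
    rw [dirDimOver_localization_eq_directrixDim_of_mem_ridge hILhom hridge hILv hIL1 Lv K' hcv, hIL_eq, Ideal.map_map]
    congr 2
    refine RingHom.ext fun p => ?_
    rw [RingHom.comp_apply, MvPolynomial.map_map, hτ]
  -- (5) the `h` hypersurface sections in the equality case
  have hHF : hilbertSamuelFun Lv h = hilbertFun B := by
    refine iterPSum_injective 1 ?_
    rw [iterPSum_hilbertSamuelFun Lv 1 h, add_comm 1 h, ← hBv]
    rfl
  have hRle : dirDimOver B K' ≤ dirDimOver Lv K' + h :=
    dirDimOver_le_dirDimOver_add_of_hilbertSamuelFun_eq hΦsurj (θ₂ ∘ t) hΦker hHF K' hKc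
  rw [hRB, hRv] at hRle
  omega

end Structure

/-! ## The theorem, for any localization of `S/I` at `𝔓/I` and any field over its residue field -/

/-- **The directrix of a cone under localization at a near prime (CJS Thm. 3.10 (4) for cones, EVERY field).** Let
`I ⊆ K[X_1, …, X_n]` be a homogeneous ideal containing no linear forms, `𝔓 ⊇ I` a prime ideal with `dim S/𝔓 = d`, `Lo` a
localization of `S/I` at `𝔓/I` (the local ring `O_{C,𝔓}`) with `H(S/I) ≤ H⁽ᵈ⁾(O_{C,𝔓})`, and `K'` ANY field over the residue
field `κ(Lo)` (imperfect allowed). Then `e(O_{C,𝔓})_{K'} + d ≤ e(I · K'[X])`, the directrix dimension of `I` extended along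
`K → S/I → Lo → κ(Lo) → K'`. [cite: CossartJannsenSaito2020, Thm. 3.10 (4)] [cite: Dietel2015, Satz (8.2.7) p. 105] -/
theorem dirDimOver_add_le_directrixDim_of_hilbertFunQuot_le_hilbertSamuelFun {K : Type u} [Field K] {n : ℕ}
    {I 𝔓 : Ideal (MvPolynomial (Fin n) K)} (hI : IsHomogeneousIdeal I) (hI1 : finrank K (idealDegree I 1) = 0) [𝔓.IsPrime]
    (hI𝔓 : I ≤ 𝔓) {d : ℕ} (hd : ringKrullDim (MvPolynomial (Fin n) K ⧸ 𝔓) = d) {P' : Ideal (MvPolynomial (Fin n) K ⧸ I)}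
    [P'.IsPrime] (hP' : P' = 𝔓.map (Ideal.Quotient.mk I)) (Lo : Type u) [CommRing Lo]
    [Algebra (MvPolynomial (Fin n) K ⧸ I) Lo] [IsLocalization.AtPrime Lo P'] [IsLocalRing Lo] [IsNoetherianRing Lo]
    (hH : hilbertFunQuot K n I ≤ hilbertSamuelFun Lo d) (K' : Type u) [Field K'] [Algebra (ResidueField Lo) K'] :
    dirDimOver Lo K' + d ≤ directrixDim (I.map (MvPolynomial.map ((algebraMap (ResidueField Lo) K').comp
      ((residue Lo).comp ((algebraMap (MvPolynomial (Fin n) K ⧸ I) Lo).comp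
        ((Ideal.Quotient.mk I).comp (C : K →+* MvPolynomial (Fin n) K))))))) := by
  classical
  set D := MvPolynomial (Fin n) K ⧸ 𝔓
  let L := FractionRing D
  haveI : (RingHom.ker (eval₂Hom ((algebraMap D L).comp (Ideal.Quotient.factor hI𝔓))
      (fun i : Fin n => algebraMap D L (Ideal.Quotient.mk 𝔓 (X i))))).IsPrime := RingHom.ker_isPrime _
  set O := Localization.AtPrime P'
  let e₀ : O ≃ₐ[MvPolynomial (Fin n) K ⧸ I] Lo := IsLocalization.algEquiv P'.primeCompl O Lo
  -- Hilbert functions along `e₀`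
  have hHO : hilbertFun O = hilbertFun Lo := hilbertFun_eq_of_ringEquiv e₀.toRingEquiv
  have hH' : hilbertFunQuot K n I ≤ hilbertSamuelFun O d := by
    change _ ≤ iterPSum d (hilbertFun O)
    rw [hHO]
    exact hH
  -- `j : D → κ(Lo)`, injective, and `λ : L = Frac D → κ(Lo)`
  let j₀ : MvPolynomial (Fin n) K →+* ResidueField Lo :=
    (residue Lo).comp ((algebraMap (MvPolynomial (Fin n) K ⧸ I) Lo).comp (Ideal.Quotient.mk I))
  have hj₀ : ∀ s ∈ 𝔓, j₀ s = 0 := fun s hs => by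
    change residue Lo (algebraMap _ Lo (Ideal.Quotient.mk I s)) = 0
    rw [residue_eq_zero_iff, IsLocalization.AtPrime.to_map_mem_maximal_iff Lo P', hP']
    exact Ideal.mem_map_of_mem _ hs
  let j : D →+* ResidueField Lo := Ideal.Quotient.lift 𝔓 j₀ hj₀
  have hjinj : Function.Injective j := by
    rw [injective_iff_map_eq_zero]
    intro x hx
    obtain ⟨s, rfl⟩ := Ideal.Quotient.mk_surjective x
    rw [Ideal.Quotient.lift_mk] at hx
    change residue Lo (algebraMap _ Lo (Ideal.Quotient.mk I s)) = 0 at hx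
    rw [residue_eq_zero_iff, IsLocalization.AtPrime.to_map_mem_maximal_iff Lo P', hP',
      Ideal.mem_quotient_iff_mem_sup, sup_eq_left.mpr hI𝔓] at hx
    exact Ideal.Quotient.eq_zero_iff_mem.mpr hx
  let lam : L →+* ResidueField Lo := IsFractionRing.lift hjinj
  have hlam : ∀ x : D, lam (algebraMap D L x) = j x := fun x => IsFractionRing.lift_algebraMap hjinj x
  letI algL : Algebra L K' := ((algebraMap (ResidueField Lo) K').comp lam).toAlgebra
  -- the field `K'` over `κ(O)`, through `e₀`
  letI algO : Algebra (ResidueField O) K' :=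
    ((algebraMap (ResidueField Lo) K').comp (ResidueField.map (e₀ : O →+* Lo))).toAlgebra
  have hcO : ∀ t : MvPolynomial (Fin n) K ⧸ I, algebraMap (ResidueField O) K' (residue O (algebraMap _ O t)) =
      algebraMap L K' (((algebraMap D L).comp (Ideal.Quotient.factor hI𝔓)) t) := fun t => by
    obtain ⟨s, rfl⟩ := Ideal.Quotient.mk_surjective t
    change (algebraMap (ResidueField Lo) K') (ResidueField.map (e₀ : O →+* Lo) (residue O _)) =
      (algebraMap (ResidueField Lo) K') (lam _)
    rw [ResidueField.map_residue, RingHom.comp_apply, Ideal.Quotient.factor_mk, hlam]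
    congr 1
    change residue Lo (e₀ (algebraMap _ O (Ideal.Quotient.mk I s))) = Ideal.Quotient.lift 𝔓 j₀ hj₀ (Ideal.Quotient.mk 𝔓 s)
    rw [AlgEquiv.commutes, Ideal.Quotient.lift_mk]
    rfl
  have hmain := dirDimOver_conePrime_add_le hI𝔓 L rfl hP' hI hI1 hd hH' K' hcO
  -- transport `e(O)_{K'} = e(Lo)_{K'}` and identify the coefficient map
  have hOLo : dirDimOver Lo K' = dirDimOver O K' := dirDimOver_eq_of_ringEquiv e₀.toRingEquiv K' rfl
  rw [hOLo]
  have hmaps : (algebraMap L K').comp ((algebraMap D L).comp (algebraMap K D)) =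
      (algebraMap (ResidueField Lo) K').comp ((residue Lo).comp ((algebraMap (MvPolynomial (Fin n) K ⧸ I) Lo).comp
        ((Ideal.Quotient.mk I).comp (C : K →+* MvPolynomial (Fin n) K)))) := by
    refine RingHom.ext fun c => ?_
    change (algebraMap (ResidueField Lo) K') (lam (algebraMap D L (algebraMap K D c))) = _
    rw [hlam]
    change (algebraMap (ResidueField Lo) K') (Ideal.Quotient.lift 𝔓 j₀ hj₀ (algebraMap K D c)) = _
    rw [IsScalarTower.algebraMap_apply K (MvPolynomial (Fin n) K) D, Ideal.Quotient.algebraMap_eq, Ideal.Quotient.lift_mk,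
      MvPolynomial.algebraMap_eq]
    rfl
  rw [hmaps] at hmain
  exact hmain

end CampaignW42

end Summit.ResolutionOfSingularities.ResolutionOfSingularities.Theorems

end
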